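/-
Copyright (c) 2026 the pub-hodgecm-mathlib formalisation cell (harness21).  Prover seat hodgecm-mathlib-K2E3-p12 (g2), Track B «K2-LIT» ∕ h413
(`stmt-HodgeConjecture-24833`), line `K2_E3_EllipticInputs`, unit U12-d «Harish-Chandra characters»: ON THE MODEL `GL_N(F)` (any non-archimedean local field `F`):
the bound «`|D|^{1∕2} Θ_π` bounded near `s₀`» at REGULAR `s₀`, at CENTRAL `s₀` from the bound at `1`, and for `N = 2` at EVERY semisimple `s₀` from the bound at `1` —
the split-place input of ★ `K2E3NormalizedCharBddNearSemisimpleModelTransport` at `N ≤ 2` reduced to the identity.  2026-09-04.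
-/
import Summits.HodgeConjecture.HodgeConjecture.Theorems.K2E3NormalizedCharBddNearSemisimpleTwoOfIdentity   -- ★ p855904 (this seat): generic `apply_mul_eq_of_mem_center`; ★ `unitRel_smul_iff`; ★ p855802 `exists_eq_smul_one_of_isSemisimple_of_not_separable`
import Summits.HodgeConjecture.HodgeConjecture.Theorems.K2E3CharLocBddOfLocal                          -- ★ p855025: `isRegularElt_of_unit_mul_det_pow_eq_discr`
import Literature.NumberTheory.Automorphic.LocalRingUnitModulusProduct                                -- ★ `distribHaarChar_eq_normAbs`
import Literature.NumberTheory.Automorphic.LocalFieldHaarBalls                                        -- ★ `LocalFieldHaar.continuous_normAbs`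
import HarnessLib

/-!
# K2_E3 road (h413 = stmt-HodgeConjecture-24833), unit U12-d on the model `GL_N(F)` — REGULAR points, CENTRAL TRANSLATION, and `N = 2` FROM THE IDENTITY

Cell `pub/hodgecm-mathlib` (D-0151), Track B (21-frontier RULING «PUSH BOTH» 2026-09-03, director req624), seat K2E3-p12 (g2), line lead of row 12 (12-S).
`--supports stmt-HodgeConjecture-24833 --as helper`; THEOREMS ONLY (no definition ∕ instance ∕ notation ∕ named fact ∕ `sorry`); never imports `Cruxes/…/Lines`.

★ `K2E3NormalizedCharBddNearSemisimpleModelTransport.normalizedCharBddNearSemisimple_of_models` (p856182) reduces socket U12-d at SPLIT places to the statement (12-GL)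
on `GL_N(L_w)` at every semisimple `s₀`: «`∃ U₀ ∋ s₀` open, `∃ B`, `√‖u₀‖_F·|Θ₀ g| ≤ B` for `g ∈ U₀`, `u₀·det(g)^{N−1} = disc χ_g`», for `Θ₀` locally constant at the regular
points and representing an admissible character.  This file (GENERIC `F`) does on `GL_N(F)` what ★ p855019∕p855904 did on `U_N(H)(L⁺_v)`:
* §1 the weight `√‖u₀‖_F = √(|disc χ_g|_F ∕ |det g|_F^{N−1})` is locally bounded everywhere (`exists_nhds_glWeight_le`; `u₀ = disc χ_g·det(g⁻¹)^{N−1}`), so (12-GL) holds at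
  every REGULAR `s₀` (`glNormalizedCharBddNear_of_eventually_eq`, Θ₀ locally constant there);
* §2 CENTRAL TRANSLATION `glNormalizedCharBddNear_smul_of_one`: (12-GL) at a scalar `z = a·1` ⟸ (12-GL) at `1` (`Θ₀(zg) = ω_π(z)Θ₀(g)` by ★ `apply_mul_eq_of_mem_center`, the admissible
  units at `zg` and `g` coincide by ★ `unitRel_smul_iff`);
* §3 `N = 2` (`F` perfect): a semisimple `s₀ ∈ GL₂(F)` is regular or scalar (★ `exists_eq_smul_one_of_isSemisimple_of_not_separable`), so **`glTwo_normalizedCharBddNearSemisimple_of_one`**: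
  (12-GL) at EVERY semisimple `s₀` ⟸ (12-GL) at `1` — which ★ p856206 reduces to the Lie-algebra core (L-A)+(L-B) on `𝔤𝔩₂(F)`.
[HarishChandra1999AdmissibleDistributions, Thm. 16.3 p. 77, §17, §21 p. 87] [BushnellHenniart2006, §2.6 Cor. 1] [Borel1991, I.4].
HONEST LABEL: HC_CM is proved only modulo the 7 printed citations (2 remaining named inputs: hLiu418 = stmt-HodgeConjecture-24832, h413 =
stmt-HodgeConjecture-24833) until rung 0 closes; reductions only.

## References
* [HarishChandra1999AdmissibleDistributions] Harish-Chandra (DeBacker–Sally), *Admissible Invariant Distributions on Reductive p-adic Groups* (1999), Thm. 16.3, §17, §21.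
* [BushnellHenniart2006] C. J. Bushnell, G. Henniart, *The Local Langlands Conjecture for GL(2)* (2006), §2.6 Corollary 1 (central character).
* [Borel1991] A. Borel, *Linear Algebraic Groups*, 2nd ed. (1991), I.4 (4.2)–(4.4).
-/

set_option autoImplicit false
set_option linter.dupNamespace false   -- `Summit.HodgeConjecture.HodgeConjecture.…` (D-0017 nested layout; lakefile exemption for Summits)

noncomputable section

open MeasureTheory Filter Topology Polynomial
open scoped Matrix MatrixGroups NNReal
open Literature.NumberTheory.Rogawski1990 Literature.NumberTheory.Automorphic Literature.NumberTheory.Automorphic.UnitaryGroup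
open Literature.NumberTheory.GaloisRepresentations Literature.NumberTheory.GaloisRepresentations.IsNonarchimedeanLocalField
open Summit.HodgeConjecture.HodgeConjecture.Cruxes.H413.K2E3NormalizedCharBddNearSemisimpleRegular
open Summit.HodgeConjecture.HodgeConjecture.Cruxes.H413.K2E3NormalizedCharBddNearSemisimpleTwoOfIdentity
open Summit.HodgeConjecture.HodgeConjecture.Cruxes.H413.K2E3CharLocBddOfLocal
open Summit.HodgeConjecture.HodgeConjecture.Cruxes.H413.K2E3CharpolyDiscrSmul
open Summit.HodgeConjecture.HodgeConjecture.Cruxes.H413.K2E3CharLocIntNearSemisimpleTwoOfIdentity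

namespace Summit.HodgeConjecture.HodgeConjecture.Cruxes.H413.K2E3GLnNormalizedCharBddNearSemisimpleOfIdentity

variable {F : Type*} [Field F] [ValuativeRel F] [TopologicalSpace F] [IsNonarchimedeanLocalField F] {N : ℕ}

/-! ## §1  The weight `√‖u₀‖_F` on `GL_N(F)` is locally bounded; (12-GL) at a point of local constancy -/

omit [ValuativeRel F] [TopologicalSpace F] [IsNonarchimedeanLocalField F] in
/-- The admissible unit is `u₀ = disc χ_g · det(g⁻¹)^{N−1}`. [cite: HarishChandra1999AdmissibleDistributions, §17] -/
theorem coe_eq_discr_mul_det_inv_pow (g : GL (Fin N) F) (u₀ : Fˣ)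
    (hu : (u₀ : F) * (((g : Matrix (Fin N) (Fin N) F)).det) ^ (N - 1) = ((g : Matrix (Fin N) (Fin N) F)).charpoly.discr) :
    (u₀ : F) = ((g : Matrix (Fin N) (Fin N) F)).charpoly.discr * ((((g⁻¹ : GL (Fin N) F)) : Matrix (Fin N) (Fin N) F)).det ^ (N - 1) := by
  have hinv : ((g : Matrix (Fin N) (Fin N) F)).det * ((((g⁻¹ : GL (Fin N) F)) : Matrix (Fin N) (Fin N) F)).det = 1 := by
    rw [← Matrix.det_mul, ← Units.val_mul, mul_inv_cancel, Units.val_one, Matrix.det_one]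
  calc (u₀ : F) = (u₀ : F) * (((g : Matrix (Fin N) (Fin N) F)).det * ((((g⁻¹ : GL (Fin N) F)) : Matrix (Fin N) (Fin N) F)).det) ^ (N - 1) := by
        rw [hinv, one_pow, mul_one]
    _ = ((g : Matrix (Fin N) (Fin N) F)).charpoly.discr * ((((g⁻¹ : GL (Fin N) F)) : Matrix (Fin N) (Fin N) F)).det ^ (N - 1) := by
        rw [mul_pow, ← mul_assoc, hu]

/-- **The weight `√‖u₀‖_F` is locally bounded at EVERY point of `GL_N(F)`** (`‖u₀‖_F = |disc χ_g·det(g⁻¹)^{N−1}|_F` is continuous in `g`).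
[cite: HarishChandra1999AdmissibleDistributions, Thm. 16.3, §17] -/
theorem exists_nhds_glWeight_le (s₀ : GL (Fin N) F) :
    ∃ U : Set (GL (Fin N) F), IsOpen U ∧ s₀ ∈ U ∧ ∃ W : ℝ, ∀ g ∈ U, ∀ u₀ : Fˣ,
      (u₀ : F) * (((g : Matrix (Fin N) (Fin N) F)).det) ^ (N - 1) = ((g : Matrix (Fin N) (Fin N) F)).charpoly.discr →
      ((NNReal.sqrt (unitModulusChar F u₀) : ℝ≥0) : ℝ) ≤ W := by
  set Φ : GL (Fin N) F → ℝ≥0 := fun g =>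
    normAbs F (((g : Matrix (Fin N) (Fin N) F)).charpoly.discr * ((((g⁻¹ : GL (Fin N) F)) : Matrix (Fin N) (Fin N) F)).det ^ (N - 1)) with hΦ
  have hΦc : Continuous Φ := by
    refine LocalFieldHaar.continuous_normAbs.comp ?_
    exact (continuous_discr_charpoly.comp Units.continuous_val).mul ((Units.continuous_coe_inv.matrix_det).pow _)
  refine ⟨Φ ⁻¹' Set.Iio (Φ s₀ + 1), hΦc.isOpen_preimage _ isOpen_Iio, ?_, ((NNReal.sqrt (Φ s₀ + 1) : ℝ≥0) : ℝ), fun g hg u₀ hu => ?_⟩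
  · exact Set.mem_preimage.2 (Set.mem_Iio.2 (lt_add_of_pos_right _ zero_lt_one))
  · have hmod : unitModulusChar F u₀ = Φ g := by
      rw [unitModulusChar, distribHaarChar_eq_normAbs, coe_eq_discr_mul_det_inv_pow g u₀ hu]
    rw [hmod]
    exact NNReal.coe_le_coe.2 (NNReal.sqrt_le_sqrt.2 (Set.mem_Iio.1 (Set.mem_preimage.1 hg)).le)

/-- **(12-GL) at a point where `Θ₀` is locally constant** — in particular at every REGULAR `s₀` under the hypothesis `hloc₀` of the model statement.
[cite: HarishChandra1999AdmissibleDistributions, Thm. 16.3 p. 77] -/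
theorem glNormalizedCharBddNear_of_eventually_eq (Θ₀ : GL (Fin N) F → ℂ) (s₀ : GL (Fin N) F) (hΘ : ∀ᶠ y in 𝓝 s₀, Θ₀ y = Θ₀ s₀) :
    ∃ U₀ : Set (GL (Fin N) F), IsOpen U₀ ∧ s₀ ∈ U₀ ∧ ∃ B : ℝ, ∀ g ∈ U₀, ∀ u₀ : Fˣ,
      (u₀ : F) * (((g : Matrix (Fin N) (Fin N) F)).det) ^ (N - 1) = ((g : Matrix (Fin N) (Fin N) F)).charpoly.discr →
      ((NNReal.sqrt (unitModulusChar F u₀) : ℝ≥0) : ℝ) * ‖Θ₀ g‖ ≤ B := by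
  obtain ⟨V, hVsub, hVo, hsV⟩ := mem_nhds_iff.1 hΘ
  obtain ⟨U, hUo, hsU, W, hW⟩ := exists_nhds_glWeight_le s₀
  refine ⟨U ∩ V, hUo.inter hVo, ⟨hsU, hsV⟩, W * ‖Θ₀ s₀‖, fun g hg u₀ hu => ?_⟩
  have hΘg : Θ₀ g = Θ₀ s₀ := hVsub hg.2
  rw [hΘg]
  exact mul_le_mul_of_nonneg_right (hW g hg.1 u₀ hu) (norm_nonneg _)

/-! ## §2  Central translation on `GL_N(F)`: (12-GL) at a scalar point from (12-GL) at `1` -/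

set_option maxHeartbeats 800000 in
/-- **(12-GL) AT A SCALAR `z` (matrix `a • 1`) FROM (12-GL) AT `1`** (`π₀` admissible irreducible, `Θ₀` locally constant at the regular points and representing `χ_{π₀}`): on
`zU₀` an admissible `u₀` at `zg` is admissible at `g` (★ `unitRel_smul_iff`), both points are regular, `Θ₀(zg) = ω_{π₀}(z)·Θ₀(g)` (★ `apply_mul_eq_of_mem_center`), so
`√‖u₀‖·|Θ₀(zg)| ≤ |ω|·B`. [cite: HarishChandra1999AdmissibleDistributions, Thm. 16.3 p. 77, §21 p. 87] [cite: BushnellHenniart2006, §2.6 Corollary 1] -/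
theorem glNormalizedCharBddNear_smul_of_one [NonarchimedeanGroup (GL (Fin N) F)] [LocallyCompactSpace (GL (Fin N) F)] [SecondCountableTopology (GL (Fin N) F)]
    [MeasurableSpace (GL (Fin N) F)] [BorelSpace (GL (Fin N) F)] (μ₀ : Measure (GL (Fin N) F)) [μ₀.IsHaarMeasure]
    (r₀ : SmoothIrrep (GL (Fin N) F)) (hadm : r₀.ρ.IsAdmissible) (Θ₀ : GL (Fin N) F → ℂ)
    (hloc₀ : ∀ x₀ : GL (Fin N) F, IsRegularElt x₀ → ∀ᶠ y in 𝓝 x₀, Θ₀ y = Θ₀ x₀)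
    (hrep₀ : ∀ φ₀ : GL (Fin N) F → ℂ, IsLocSmooth φ₀ → (IrrClass.mk r₀).smoothTrace μ₀ φ₀ = ∫ x, φ₀ x * Θ₀ x ∂μ₀)
    (z : GL (Fin N) F) (a : Fˣ) (hz : ((z : Matrix (Fin N) (Fin N) F)) = (a : F) • (1 : Matrix (Fin N) (Fin N) F))
    (h1 : ∃ U₀ : Set (GL (Fin N) F), IsOpen U₀ ∧ (1 : GL (Fin N) F) ∈ U₀ ∧ ∃ B : ℝ, ∀ g ∈ U₀, ∀ u₀ : Fˣ,
      (u₀ : F) * (((g : Matrix (Fin N) (Fin N) F)).det) ^ (N - 1) = ((g : Matrix (Fin N) (Fin N) F)).charpoly.discr →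
      ((NNReal.sqrt (unitModulusChar F u₀) : ℝ≥0) : ℝ) * ‖Θ₀ g‖ ≤ B) :
    ∃ U₀ : Set (GL (Fin N) F), IsOpen U₀ ∧ z ∈ U₀ ∧ ∃ B : ℝ, ∀ g ∈ U₀, ∀ u₀ : Fˣ,
      (u₀ : F) * (((g : Matrix (Fin N) (Fin N) F)).det) ^ (N - 1) = ((g : Matrix (Fin N) (Fin N) F)).charpoly.discr →
      ((NNReal.sqrt (unitModulusChar F u₀) : ℝ≥0) : ℝ) * ‖Θ₀ g‖ ≤ B := by
  -- `z` is central
  have hzc : z ∈ Subgroup.center (GL (Fin N) F) := by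
    rw [Matrix.GeneralLinearGroup.mem_center_iff_val_mem_range_scalar]
    exact ⟨a, by rw [hz, Matrix.scalar_apply, Matrix.smul_one_eq_diagonal]⟩
  obtain ⟨ω, hω⟩ := exists_apply_eq_algebraMap_of_mem_center r₀ hzc
  obtain ⟨U, hUo, h1U, B, hB⟩ := h1
  refine ⟨(fun x => z * x) '' U, isOpenMap_mul_left z U hUo, ⟨1, h1U, mul_one z⟩, ‖ω‖ * max B 0, ?_⟩
  rintro g' ⟨g, hgU, rfl⟩ u₀ hu
  have hmat : (((z * g : GL (Fin N) F)) : Matrix (Fin N) (Fin N) F) = (a : F) • ((g : Matrix (Fin N) (Fin N) F)) := by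
    rw [Units.val_mul, hz, smul_mul_assoc, one_mul]
  rw [hmat] at hu
  have hu' := (unitRel_smul_iff _ a (u₀ : F)).1 hu
  have hreg : IsRegularElt g := isRegularElt_of_unit_mul_det_pow_eq_discr _ u₀ (N - 1) hu'
  have hreg' : IsRegularElt (z * g) := by
    refine isRegularElt_of_unit_mul_det_pow_eq_discr _ u₀ (N - 1) ?_
    rw [hmat]
    exact hu
  have hΘ : Θ₀ (z * g) = ω * Θ₀ g := apply_mul_eq_of_mem_center μ₀ r₀ hadm hzc hω Θ₀ hrep₀ (hloc₀ g hreg) (hloc₀ (z * g) hreg')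
  have hb : ((NNReal.sqrt (unitModulusChar F u₀) : ℝ≥0) : ℝ) * ‖Θ₀ g‖ ≤ max B 0 := (hB g hgU u₀ hu').trans (le_max_left _ _)
  rw [hΘ, norm_mul]
  calc ((NNReal.sqrt (unitModulusChar F u₀) : ℝ≥0) : ℝ) * (‖ω‖ * ‖Θ₀ g‖)
      = ‖ω‖ * (((NNReal.sqrt (unitModulusChar F u₀) : ℝ≥0) : ℝ) * ‖Θ₀ g‖) := by ring
    _ ≤ ‖ω‖ * max B 0 := mul_le_mul_of_nonneg_left hb (norm_nonneg _)

/-! ## §3  `N = 2`: every semisimple point of `GL₂(F)` is regular or scalar, so (12-GL) at all semisimple points follows from (12-GL) at `1` -/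

set_option maxHeartbeats 800000 in
/-- **(12-GL) ON `GL₂(F)` AT EVERY SEMISIMPLE POINT FROM (12-GL) AT `1`** (`F` perfect, e.g. of characteristic `0`): a semisimple `s₀` with separable `χ_{s₀}` is regular
(§1), otherwise scalar (★ `exists_eq_smul_one_of_isSemisimple_of_not_separable`) and §2 applies.  This is the `N = 2` split-place model input of ★ p856182 reduced to the
identity, which ★ `K2E3GLnNormalizedCharBddNearIdentityOfLieCore` reduces to the Lie-algebra core on `𝔤𝔩₂(F)`. [cite: HarishChandra1999AdmissibleDistributions, Thm. 16.3 p. 77]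
[cite: Borel1991, I.4 (4.2)–(4.4)] -/
theorem glTwo_normalizedCharBddNearSemisimple_of_one [PerfectField F]
    [NonarchimedeanGroup (GL (Fin 2) F)] [LocallyCompactSpace (GL (Fin 2) F)] [SecondCountableTopology (GL (Fin 2) F)]
    [MeasurableSpace (GL (Fin 2) F)] [BorelSpace (GL (Fin 2) F)] (μ₀ : Measure (GL (Fin 2) F)) [μ₀.IsHaarMeasure]
    (r₀ : SmoothIrrep (GL (Fin 2) F)) (hadm : r₀.ρ.IsAdmissible) (Θ₀ : GL (Fin 2) F → ℂ)
    (hloc₀ : ∀ x₀ : GL (Fin 2) F, IsRegularElt x₀ → ∀ᶠ y in 𝓝 x₀, Θ₀ y = Θ₀ x₀)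
    (hrep₀ : ∀ φ₀ : GL (Fin 2) F → ℂ, IsLocSmooth φ₀ → (IrrClass.mk r₀).smoothTrace μ₀ φ₀ = ∫ x, φ₀ x * Θ₀ x ∂μ₀)
    (h1 : ∃ U₀ : Set (GL (Fin 2) F), IsOpen U₀ ∧ (1 : GL (Fin 2) F) ∈ U₀ ∧ ∃ B : ℝ, ∀ g ∈ U₀, ∀ u₀ : Fˣ,
      (u₀ : F) * (((g : Matrix (Fin 2) (Fin 2) F)).det) ^ (2 - 1) = ((g : Matrix (Fin 2) (Fin 2) F)).charpoly.discr →
      ((NNReal.sqrt (unitModulusChar F u₀) : ℝ≥0) : ℝ) * ‖Θ₀ g‖ ≤ B)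
    (s₀ : GL (Fin 2) F) (hss : Module.End.IsSemisimple (Matrix.toLin' ((s₀ : Matrix (Fin 2) (Fin 2) F)))) :
    ∃ U₀ : Set (GL (Fin 2) F), IsOpen U₀ ∧ s₀ ∈ U₀ ∧ ∃ B : ℝ, ∀ g ∈ U₀, ∀ u₀ : Fˣ,
      (u₀ : F) * (((g : Matrix (Fin 2) (Fin 2) F)).det) ^ (2 - 1) = ((g : Matrix (Fin 2) (Fin 2) F)).charpoly.discr →
      ((NNReal.sqrt (unitModulusChar F u₀) : ℝ≥0) : ℝ) * ‖Θ₀ g‖ ≤ B := by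
  by_cases hreg : IsRegularElt s₀
  · exact glNormalizedCharBddNear_of_eventually_eq Θ₀ s₀ (hloc₀ s₀ hreg)
  · rw [isRegularElt_iff] at hreg
    obtain ⟨a, ha⟩ := exists_eq_smul_one_of_isSemisimple_of_not_separable _ hss hreg
    have ha0 : a ≠ 0 := by
      intro h0
      rw [h0, zero_smul] at ha
      have hdet := Matrix.isUnits_det_units s₀
      haveI : Nonempty (Fin 2) := ⟨0⟩
      rw [ha, Matrix.det_zero] at hdet
      exact not_isUnit_zero hdet
    exact glNormalizedCharBddNear_smul_of_one μ₀ r₀ hadm Θ₀ hloc₀ hrep₀ s₀ (Units.mk0 a ha0) ha h1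

end Summit.HodgeConjecture.HodgeConjecture.Cruxes.H413.K2E3GLnNormalizedCharBddNearSemisimpleOfIdentity

end
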